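import Summits.CriticalPhenomena.PercolationContinuityZ3.Theorems.PercLowPointHalfSpaceTallClusterMassBoundStubSubharmonicTransfer
import Summits.CriticalPhenomena.PercolationContinuityZ3.Theorems.PercLowPointHalfSpaceAssemblyReduction

/-!
# `TallClusterMassBound` (stmt-CriticalPhenomena-0912, crux B of route PercLowPointHalfSpace) — the relaxed-exponent
# form `B_all` in ROUTE VOCABULARY and what it does for the route (line `SketchIdeator4`, lead c4)

B is `MassBoundAt p_c (11/4)` (`Negative.tallClusterMassBound_iff`, `Iff.rfl`):
`∃ C, ∀ r ≥ 1, Σ_{x ∈ B_r} P_{p_c}(0 ↔_ℍ x, arm_ℍ(0,r)) ≤ C r^{11/4} π_s(r)`.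
Its relaxed-exponent form, written with Literature constants only (exactly as the gate prints route items), is

  `B_all := ∀ m > 11/4, ∃ C, ∀ r ≥ 1, Σ_{x ∈ B_r} P_{p_c}(0 ↔_ℍ x, arm_ℍ(0,r)) ≤ C r^m π_s(r)`.

This file records, as theorems over the route's own declarations:

* `tallClusterMassBoundAll_of_squareSubharmonic` — **`B_all` follows from the EXISTING crux `SquareSubharmonic`
  (stmt-CriticalPhenomena-11506, route PercSubharmonicSquare) VERBATIM** (landed `massBoundAt_of_squareSubharmonic`, p118651:
  exterior maximum principle against the lattice Green function ⟹ `τ_{p_c}(0,x) ≤ C‖x‖^{-1/2}` ⟹ `typicalMax ≲ r^{11/4}` ⟹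
  ARROW 1 of the tightness line, whose `log r` is absorbed by `r^{m - 11/4}`).
* `tallClusterMassBoundAll_of_tallClusterMassBound` — B ⟹ `B_all` (monotonicity in the exponent), so `B_all` is a WEAKENING of B.
* `lowPointBookkeeping_of_allForm` — the bookkeeping crux K (`LowPointBookkeeping := A → B → C → τ_{p_c}(0, n e₀) → 0`) stated with
  `B_all` in place of B IMPLIES K as filed (weaker hypothesis ⟹ stronger implication).
* `percolationContinuityZ3_of_allForm` — the route's deciding theorem goes through verbatim with `B_all` in place of B:
  `A → B_all → C → K_all → θ(p_c(ℤ³)) = 0` (`θ² ≤ τ`, `LowPoint.percolationContinuityZ3_of_tendsto_openConn`).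

Why this matters (lead c4's verdict, crux dossier `Cruxes/TallClusterMassBound/Lines/SketchIdeator4-verdict-c4.md`): crux A supplies
`a₂ = 5/2 + κ` for SOME `κ > 0` and K's dyadic bookkeeping needs only `2m - 3 < a₂`, i.e. `m < 11/4 + κ/2`; so `B_all` serves the route
exactly as B does, while the surplus content of B over `B_all` (the exponent pinned AT `11/4`) is, modulo stmt-11506, a cross-scale
wall volume-versus-radius regularity statement (`ArrowOneVolRad`, p130878) that three dead lines could not supply and the route never uses.
No definitions; no new facts. [folklore]
-/

noncomputable section

open MeasureTheory Finset Filter Topology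
open Literature.Probability.Percolation Literature.Probability.LatticeModels
open Summit.CriticalPhenomena.PercolationContinuityZ3.Theses.PercLowPointHalfSpace
  (TallClusterMassBound BoundaryTwoArmDecay QuantitativeBGN LowPointBookkeeping)
open Summit.CriticalPhenomena.PercolationContinuityZ3.Theses.PercSubharmonicSquare (SquareSubharmonic)
open Summit.CriticalPhenomena.PercolationContinuityZ3.Theorems.TallClusterMassBound.Negative
open Summit.CriticalPhenomena.PercolationContinuityZ3.Theorems.TallClusterMassBound.TightnessLine
  (massBoundAt_of_squareSubharmonic)

namespace Summit.CriticalPhenomena.PercolationContinuityZ3.Theorems.TallClusterMassBound.Restatement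

/-- **`B_all` from the existing crux `SquareSubharmonic` (stmt-CriticalPhenomena-11506), route vocabulary.** For every `m > 11/4`
there is `C` with `Σ_{x ∈ B_r} P_{p_c}(0 ↔_ℍ x, arm_ℍ(0,r)) ≤ C r^m π_s(r)` for all `r ≥ 1` (landed `massBoundAt_of_squareSubharmonic`,
read back through `MassBoundAt`, which is this display by definition). [folklore] -/
theorem tallClusterMassBoundAll_of_squareSubharmonic :
    Summit.CriticalPhenomena.PercolationContinuityZ3.Theses.PercSubharmonicSquare.SquareSubharmonic →
      ∀ m : ℝ, (11 : ℝ) / 4 < m → ∃ C : ℝ, ∀ r : ℕ, 1 ≤ r →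
        ∑ x ∈ Literature.Probability.LatticeModels.box 3 r,
            (Literature.Probability.Percolation.bondPercolation (Literature.Probability.LatticeModels.zdGraph 3)
                (Literature.Probability.Percolation.criticalProbI 3)).real
              (Literature.Probability.Percolation.openConnIn {x : Literature.Probability.LatticeModels.Site 3 | 0 ≤ x 0} 0 x ∩
                {ω | ∃ y : Literature.Probability.LatticeModels.Site 3, (∃ i : Fin 3, (r : ℤ) ≤ |y i|) ∧
                  ω ∈ Literature.Probability.Percolation.openConnIn
                    {x : Literature.Probability.LatticeModels.Site 3 | 0 ≤ x 0} 0 y}) ≤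
          C * (r : ℝ) ^ m *
            (Literature.Probability.Percolation.bondPercolation (Literature.Probability.LatticeModels.zdGraph 3)
                (Literature.Probability.Percolation.criticalProbI 3)).real
              {ω | ∃ y : Literature.Probability.LatticeModels.Site 3, (∃ i : Fin 3, (r : ℤ) ≤ |y i|) ∧
                ω ∈ Literature.Probability.Percolation.openConnIn
                  {x : Literature.Probability.LatticeModels.Site 3 | 0 ≤ x 0} 0 y} :=
  fun h m hm => massBoundAt_of_squareSubharmonic h m hm

/-- **B ⟹ `B_all`** (monotonicity of `s ↦ MassBoundAt p s`, `massBoundAt_mono`): the relaxed form is a weakening of the crux as filed.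
[folklore] -/
theorem tallClusterMassBoundAll_of_tallClusterMassBound :
    Summit.CriticalPhenomena.PercolationContinuityZ3.Theses.PercLowPointHalfSpace.TallClusterMassBound →
      ∀ m : ℝ, (11 : ℝ) / 4 < m → ∃ C : ℝ, ∀ r : ℕ, 1 ≤ r →
        ∑ x ∈ Literature.Probability.LatticeModels.box 3 r,
            (Literature.Probability.Percolation.bondPercolation (Literature.Probability.LatticeModels.zdGraph 3)
                (Literature.Probability.Percolation.criticalProbI 3)).real
              (Literature.Probability.Percolation.openConnIn {x : Literature.Probability.LatticeModels.Site 3 | 0 ≤ x 0} 0 x ∩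
                {ω | ∃ y : Literature.Probability.LatticeModels.Site 3, (∃ i : Fin 3, (r : ℤ) ≤ |y i|) ∧
                  ω ∈ Literature.Probability.Percolation.openConnIn
                    {x : Literature.Probability.LatticeModels.Site 3 | 0 ≤ x 0} 0 y}) ≤
          C * (r : ℝ) ^ m *
            (Literature.Probability.Percolation.bondPercolation (Literature.Probability.LatticeModels.zdGraph 3)
                (Literature.Probability.Percolation.criticalProbI 3)).real
              {ω | ∃ y : Literature.Probability.LatticeModels.Site 3, (∃ i : Fin 3, (r : ℤ) ≤ |y i|) ∧
                ω ∈ Literature.Probability.Percolation.openConnIn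
                  {x : Literature.Probability.LatticeModels.Site 3 | 0 ≤ x 0} 0 y} :=
  fun h _ hm => massBoundAt_mono hm.le (tallClusterMassBound_iff.1 h)

/-- **K with `B_all` implies K as filed.** If the bookkeeping holds from the WEAKER mass hypothesis `B_all`
(`A → B_all → C → τ_{p_c}(0, n e₀) → 0`), then `LowPointBookkeeping` (`A → B → C → …`) holds, since B ⟹ `B_all`. [folklore] -/
theorem lowPointBookkeeping_of_allForm
    (hK : BoundaryTwoArmDecay →
      (∀ m : ℝ, (11 : ℝ) / 4 < m → MassBoundAt (criticalProbI 3) m) →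
        QuantitativeBGN →
          Tendsto (fun n : ℕ => (bondPercolation (zdGraph 3) (criticalProbI 3)).real
            (openConn (0 : Site 3) (Pi.single 0 (n : ℤ) : Site 3))) atTop (𝓝 0)) :
    LowPointBookkeeping :=
  fun hA hB hC => hK hA (fun _ hm => massBoundAt_mono hm.le (tallClusterMassBound_iff.1 hB)) hC

/-- **The route's deciding theorem with `B_all` in place of B.** `A`, `B_all`, `C` and the bookkeeping from `B_all` give
`θ(p_c(ℤ³)) = 0` exactly as `closes` does: `θ(p_c)² ≤ τ_{p_c}(0, n e₀) → 0`
(`LowPoint.percolationContinuityZ3_of_tendsto_openConn`). [folklore] -/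
theorem percolationContinuityZ3_of_allForm (hA : BoundaryTwoArmDecay)
    (hB : ∀ m : ℝ, (11 : ℝ) / 4 < m → MassBoundAt (criticalProbI 3) m) (hC : QuantitativeBGN)
    (hK : BoundaryTwoArmDecay →
      (∀ m : ℝ, (11 : ℝ) / 4 < m → MassBoundAt (criticalProbI 3) m) →
        QuantitativeBGN →
          Tendsto (fun n : ℕ => (bondPercolation (zdGraph 3) (criticalProbI 3)).real
            (openConn (0 : Site 3) (Pi.single 0 (n : ℤ) : Site 3))) atTop (𝓝 0)) :
    _root_.PercolationContinuityZ3 :=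
  LowPoint.percolationContinuityZ3_of_tendsto_openConn (fun n : ℕ => (Pi.single 0 (n : ℤ) : Site 3)) (hK hA hB hC)

/-- **`SquareSubharmonic` discharges the mass hypothesis of the relaxed deciding theorem:** with stmt-11506, the route closes from
`A`, `C` and the bookkeeping-from-`B_all` alone. [folklore] -/
theorem percolationContinuityZ3_of_squareSubharmonic_of_allForm
    (h : Summit.CriticalPhenomena.PercolationContinuityZ3.Theses.PercSubharmonicSquare.SquareSubharmonic)
    (hA : BoundaryTwoArmDecay) (hC : QuantitativeBGN)
    (hK : BoundaryTwoArmDecay →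
      (∀ m : ℝ, (11 : ℝ) / 4 < m → MassBoundAt (criticalProbI 3) m) →
        QuantitativeBGN →
          Tendsto (fun n : ℕ => (bondPercolation (zdGraph 3) (criticalProbI 3)).real
            (openConn (0 : Site 3) (Pi.single 0 (n : ℤ) : Site 3))) atTop (𝓝 0)) :
    _root_.PercolationContinuityZ3 :=
  percolationContinuityZ3_of_allForm hA (massBoundAt_of_squareSubharmonic h) hC hK

end Summit.CriticalPhenomena.PercolationContinuityZ3.Theorems.TallClusterMassBound.Restatement
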